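import Literature.MathematicalPhysics.QuantumFieldTheory.Balaban1983to89.B14LettersScaleN

/-!
# `Balaban1983to89.B14.LettersScaleNLocal` — [Balaban1988Convergent] (2.38) p. 261 «on □∩X» / p. 276 «with η replaced
# by L⁻ⁿ»: the sup, gradient and (I.4.18) letters of `…B14.LettersScaleN` under LOCAL hypotheses — the (2.38)-shaped
# sizes and the (I.3.32) Hölder letter assumed only on a box of the fine lattice, as print states them — via the
# coordinatewise CLAMPING retraction and the locality of the averaging `Q_j(1, ·)`

HONEST FRAMING (cell `pub-ymgap`, Track A DAG node N11 = [B14]; count-neutral SLOT input): a fidelity upgrade of the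
landed knit `…B14.LettersScaleN` (hypotheses on a box instead of on all of `ℤ^d`); no new estimate of Bałaban's is
claimed; the flat-background / `ℤ^d` model of the [I]-side files (`…B12Ineq417Flat`, `…B12Ineq418Flat`) is inherited as
is; Bałaban's minimizers `U_k` are not instantiated; one finite T⁴ programme at fixed ε; nothing here is a claim about
the continuum, ℝ⁴, OS axioms, a mass gap or the Clay problem.

CITATION HEADER (lean-in-tree rule).  T. Bałaban, *Convergent renormalization expansions for lattice gauge theories*,
Commun. Math. Phys. **119** (1988) 243–285, doi:10.1007/bf01217741 [Balaban1988Convergent] («[III]»; held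
`paper:balaban1988-cmp119-convergent-renormalization`, journal page = PDF page + 242); T. Bałaban, *Renormalization group
approach to lattice gauge field theories. I*, Commun. Math. Phys. **109** (1987) 249–301 [Balaban1987RG1] («[I]»);
T. Bałaban, *Averaging operations for lattice gauge theories*, Commun. Math. Phys. **98** (1985) 17–51
[Balaban1985Averaging] («[7]»).  THE PRINT, verbatim.  [III] p. 261 (2.38): *«For each cube □ ⊂ Ω_n∖Ω_{n+2}, … there
exists a gauge transformation u defined on □∩X and such, that U^u = exp iξA, Lⁿξ|A|, (Lⁿξ)²|∇^ξA| < BCMα_{0,n} (2.38) on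
□∩X, with an absolute constant B.»*; p. 276: *«Thus, for terms connected with such a cube □, we obtain all the formulas
and bounds of Sects. 3, 4 [I] with η replaced by L⁻ⁿ.»*; p. 280: *«satisfies the bound (I.3.32), but in the L⁻ⁿ-scale
instead of the η-scale»*; [7] p. 24: *«this definition is local in the sense that Ū^k_c, c ⊂ Ω^{(k)}, depends only on
the bond variables U_b for b ⊂ B^k(c₋) ∪ B^k(c₊)»*; [I] p. 285 (4.17), (4.18) as quoted in `…B14.LettersScaleN`.

WHY THIS FILE (cell `pub-ymgap`, seat dag-n11-b, census item (c″) of HOME/HANDOFF-dag-n11-b.md; the honest caveat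
(iii) of `…B14.LettersScaleN`).  The landed knit states its letters globally on `ℤ^d` because the [I]-side theorems do;
print states (2.38) on `□∩X` only.  For the sup and gradient letters the passage is formal: composing the field with the
coordinatewise clamping retraction `π_W(x)_i = max(lo_i, min(x_i, hi_i))` onto a box `W = [lo, hi]` produces a field on
all of `ℤ^d` with the SAME sup and (since one unit step moves `π_W(x)` by `0` or by that unit step) the SAME
first-difference letter, equal to the original on `W`, so by the locality of `Q_j(1, ·)` the [I]-side theorems apply BY
NAME.  Clamping does NOT preserve the second-difference (Hölder) letter — near a `ν`-face, with `λ = ν`, a first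
difference appears where a second difference should — so for (I.4.18) the one proof step of `…B12Ineq418Flat` that
consumes the Hölder letter (`norm_secondDiff_logIter_le`) is REPEATED here with that letter assumed only at the base
points it actually uses (the fine box `[Lʲz, Lʲz + (Lʲ−1)𝟙 + Lʲe_μ + (Lʲ−1)e_ν]`); everything else stays by name.

WHAT IS PROVED (kernel-checked, theorems only, no `def`, no `sorry`, standard axioms).  §1 (private) the clamping
retraction: lands in the box, is the identity on it, moves by `0` or `e_ν` under a unit step.  §2 `locB_clamp_eq`
(locality: `B_μ(z)` built on `A` equals the one built on `A∘π_W` when the block of `(z, μ)` lies in `W`),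
`norm_locB_scaleN_local` (`‖B_μ(z)‖ ≤ 2a·LʲL⁻ⁿ`), `ineq417_scaleN_local` (`‖∂_νB_μ(z)‖ ≤ (2c₁a + 4da′)(LʲL⁻ⁿ)²`) under
the letters ON A BOX containing the blocks of `z`, `z + e_ν`.  §3 `norm_dd2Cfg_le_local`,
`norm_secondDiff_logIter_le_local`, `ineq418_flat_local`, `ineq418_flat_scaled_local` (the [I]-side (4.18) chain with
the Hölder letter local, proofs repeated verbatim otherwise) and `ineq418_scaleN_local`:
`‖∂_λ∂_νB_μ(z)‖ ≤ (4da″ + 32C₃a′² + 8dc₁a′ + 2c₂a)(LʲL⁻ⁿ)²θ` under ALL letters on a box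
`[lo, hi] ⊇ [Lʲz, Lʲz + (Lʲ−1)𝟙 + Lʲe_μ + 2Lʲ𝟙]` only.  The pieces / (3.49)-consumer corollaries under local hypotheses
are in the sibling `…B14LettersScaleNLocalPieces`.

WHAT IS NOT PROVED HERE (and not claimed): as `…B14.LettersScaleN` (i), (ii), (iv); the global-in-`ℤ^d` PROFILE letters
of `ζ̃` are kept (the partition function is ours to define everywhere); the box must contain a `2Lʲ`-collar of the blocks
(print's `□̃`-type enlargements, (1.11)/(2.15), are not matched to it here).
Unit `pub-ymgap-dag-n11-b` (generation 2), HOME `run/shared/lean/pub/pub-ymgap/`.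

## References
* [Balaban1988Convergent] T. Bałaban, Commun. Math. Phys. 119 (1988) 243–285: (2.38) p.261, p.276, p.280.
* [Balaban1987RG1] T. Bałaban, Commun. Math. Phys. 109 (1987) 249–301 ([I]: (3.32) p.277, (4.17)–(4.18) p.285).
* [Balaban1985Averaging] T. Bałaban, Commun. Math. Phys. 98 (1985) 17–51 ([7]: p.24, Prop. 4 p.38, Prop. 5 (156) p.42).
-/

noncomputable section

open scoped BigOperators
open Finset
open Literature.MathematicalPhysics.QuantumFieldTheory.Balaban1983to89
open Literature.MathematicalPhysics.QuantumFieldTheory.Balaban1983to89.B7Prop1Explicit (e)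
open Literature.MathematicalPhysics.QuantumFieldTheory.Balaban1983to89.B7Prop1Local (InBox AgreeOn loK bondHiK)
open Literature.MathematicalPhysics.QuantumFieldTheory.Balaban1983to89.B7Prop3Flat (insCfg)
open Literature.MathematicalPhysics.QuantumFieldTheory.Balaban1983to89.B7Prop4Flat (logIter)
open Literature.MathematicalPhysics.QuantumFieldTheory.Balaban1983to89.B7Prop5Flat (C3 C3_pos logIter_congr restr
  mem_bondsIn mem_boxFinset BondIn)
open Literature.MathematicalPhysics.QuantumFieldTheory.Balaban1983to89.B7Prop5FlatOperator (avgMap avgMap_apply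
  norm_insCfg_le_of_le analyticAt_avgMap_apply differentiableAt_avgMap_real opNorm_fderiv_real_avgMap_le)
open Literature.MathematicalPhysics.QuantumFieldTheory.Balaban1983to89.B12Ineq417Flat (shiftCfg shiftCfg_apply
  logIter_shiftCfg norm_shiftCfg_sub_le locB dlocB boxBonds oneBond theBond logIter_eq_avgMap_restr norm_logIter_le
  norm_logIter_shift_sub_le ineq417_flat_scaled)
open Literature.MathematicalPhysics.QuantumFieldTheory.Balaban1983to89.B12Ineq418Flat (ddlocB eq418_split dd2Cfg
  dd2Cfg_eq_sum secondDiff_logIter_eq norm_secondDiff_le)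

namespace Literature.MathematicalPhysics.QuantumFieldTheory.Balaban1983to89.B14.LettersScaleNLocal

variable {d : ℕ}

/-! ## §1. The clamping retraction onto a box of `ℤ^d` -/

/-- Clamping a site into the box `[lo, hi]` coordinatewise, `π(x)_i = max(lo_i, min(x_i, hi_i))` (no `def`: the term is
spelled out where used), lands in the box. [folklore] -/
private theorem clamp_mem {lo hi : B7Prop1Explicit.Site d} (hbox : ∀ i, lo i ≤ hi i) (x : B7Prop1Explicit.Site d) :
    InBox lo hi (fun i => max (lo i) (min (x i) (hi i))) := fun i =>
  ⟨le_max_left _ _, max_le (hbox i) (min_le_right _ _)⟩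

/-- Clamping is the identity on the box. [folklore] -/
private theorem clamp_eq_self {lo hi x : B7Prop1Explicit.Site d} (hx : InBox lo hi x) :
    (fun i => max (lo i) (min (x i) (hi i))) = x := by
  funext i
  obtain ⟨h1, h2⟩ := hx i
  rw [min_eq_left h2, max_eq_right h1]

/-- One unit step moves the clamped point by `0` or by the same unit step. [folklore] -/
private theorem clamp_step (lo hi x : B7Prop1Explicit.Site d) (ν : Fin d) :
    (fun i => max (lo i) (min ((x + e ν) i) (hi i))) = (fun i => max (lo i) (min (x i) (hi i)))
      ∨ (fun i => max (lo i) (min ((x + e ν) i) (hi i))) = (fun i => max (lo i) (min (x i) (hi i))) + e ν := by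
  by_cases h : lo ν ≤ x ν + 1 ∧ x ν + 1 ≤ hi ν ∧ lo ν ≤ x ν
  · right
    funext i
    simp only [Pi.add_apply, B7Prop1Explicit.e_apply]
    by_cases hi' : i = ν
    · subst hi'; simp only [if_true]; omega
    · simp only [if_neg hi', add_zero]
  · left
    funext i
    simp only [Pi.add_apply, B7Prop1Explicit.e_apply]
    by_cases hi' : i = ν
    · subst hi'; simp only [if_true]; omega
    · simp only [if_neg hi', add_zero]

/-! ## §2. Locality: the localized field at `z` sees only the block of `z` -/

section Local

variable {𝔸 : Type*} [NormedRing 𝔸] [NormedAlgebra ℂ 𝔸] [CompleteSpace 𝔸]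

/-- **Locality**: if the block box `[Lʲz, Lʲz + (Lʲ−1)𝟙 + Lʲe_μ]` of the coarse bond `(z, μ)` lies in `[lo, hi]`, the
localized field `B_μ(z)` built on `A` equals the one built on the CLAMPED field `A∘π_{[lo,hi]}`
(`π_{[lo,hi]}(x)_i = max(lo_i, min(x_i, hi_i))`; `…B7Prop5Flat.logIter_congr` BY NAME: «Ū^k_c depends only on the bond
variables U_b for b ⊂ B^k(c₋) ∪ B^k(c₊)»). [cite: Balaban1985Averaging, p.24 (sentence after (43))] (elementary API; our proof) -/
theorem locB_clamp_eq (ζ : B7Prop1Explicit.Site d → ℝ) (L : ℕ) (hL : 1 ≤ L) (A : B7Prop1Explicit.Site d → Fin d → 𝔸)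
    (j : ℕ) (z : B7Prop1Explicit.Site d) (μ : Fin d) (η : ℝ) {lo hi : B7Prop1Explicit.Site d}
    (hblk : ∀ i, lo i ≤ loK L j z i ∧ bondHiK L j z μ i ≤ hi i) :
    locB ζ L ((η : ℂ) • fun (x : B7Prop1Explicit.Site d) (κ : Fin d) => A (fun i => max (lo i) (min (x i) (hi i))) κ) j z μ
      = locB ζ L ((η : ℂ) • A) j z μ := by
  unfold locB
  congr 1
  refine logIter_congr L hL j z μ fun x κ hx hx' => ?_
  have hxin : InBox lo hi x := fun i => ⟨(hblk i).1.trans (hx i).1, (hx i).2.trans (hblk i).2⟩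
  simp only [Pi.smul_apply]
  rw [clamp_eq_self hxin]

omit [NormedAlgebra ℂ 𝔸] [CompleteSpace 𝔸] in
/-- Global sup letter of the clamped field from the LOCAL one (clamped points lie in the box). [folklore] -/
private theorem clamp_sup {lo hi : B7Prop1Explicit.Site d} (hbox : ∀ i, lo i ≤ hi i) (A : B7Prop1Explicit.Site d → Fin d → 𝔸)
    {a : ℝ} (hA : ∀ x, InBox lo hi x → ∀ κ, ‖A x κ‖ ≤ a) :
    ∀ x κ, ‖(fun (x : B7Prop1Explicit.Site d) (κ : Fin d) => A (fun i => max (lo i) (min (x i) (hi i))) κ) x κ‖ ≤ a :=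
  fun x κ => hA _ (clamp_mem hbox x) κ

omit [NormedAlgebra ℂ 𝔸] [CompleteSpace 𝔸] in
/-- Global fine-difference letter of the clamped field from the LOCAL one (a unit step moves the clamped point by `0`
or by the same unit step, inside the box). [folklore] -/
private theorem clamp_diff {lo hi : B7Prop1Explicit.Site d} (hbox : ∀ i, lo i ≤ hi i) (A : B7Prop1Explicit.Site d → Fin d → 𝔸)
    (ν : Fin d) {g : ℝ} (hg : 0 ≤ g)
    (hA' : ∀ x, InBox lo hi x → InBox lo hi (x + e ν) → ∀ κ, ‖A (x + e ν) κ - A x κ‖ ≤ g) :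
    ∀ x κ, ‖(fun (x : B7Prop1Explicit.Site d) (κ : Fin d) => A (fun i => max (lo i) (min (x i) (hi i))) κ) (x + e ν) κ
      - (fun (x : B7Prop1Explicit.Site d) (κ : Fin d) => A (fun i => max (lo i) (min (x i) (hi i))) κ) x κ‖ ≤ g := by
  intro x κ
  rcases clamp_step lo hi x ν with h | h
  · simp only [h, sub_self, norm_zero]; exact hg
  · simp only [h]
    have hm := clamp_mem hbox x
    have hm' : InBox lo hi ((fun i => max (lo i) (min (x i) (hi i))) + e ν) := by rw [← h]; exact clamp_mem hbox _
    exact hA' _ hm hm' κ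

/-- **The size of `B` «in the L⁻ⁿ-scale» under LOCAL hypotheses**: `‖B_μ(z)‖ ≤ 2a·LʲL⁻ⁿ` for
`B_μ = ζ̃·Q_{j,μ}(L⁻ⁿA)` when (2.38)'s `Lⁿξ|A| < c` (here `‖A‖ ≤ a`) holds ON A BOX `[lo, hi]` containing the block of
`(z, μ)` — print: (2.38) «on □∩X» — `|ζ̃(z)| ≤ 1` and b07's smallness; by clamping + `…B14.LettersScaleN.norm_locB_scaleN`'s
ingredients BY NAME. [cite: Balaban1988Convergent, (2.38) p.261, p.276; Balaban1987RG1, p.277] -/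
theorem norm_locB_scaleN_local (ζ : B7Prop1Explicit.Site d → ℝ) (L : ℕ) (hL : 2 ≤ L)
    (A : B7Prop1Explicit.Site d → Fin d → 𝔸) (j n : ℕ) (z : B7Prop1Explicit.Site d) (μ : Fin d) {η a : ℝ}
    (hη : η = ((L : ℝ) ^ n)⁻¹) (ha : 0 ≤ a) (hk : C3 d L * ((L : ℝ) ^ j * (η * a)) ≤ 1)
    {lo hi : B7Prop1Explicit.Site d} (hbox : ∀ i, lo i ≤ hi i)
    (hblk : ∀ i, lo i ≤ loK L j z i ∧ bondHiK L j z μ i ≤ hi i)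
    (hA : ∀ x, InBox lo hi x → ∀ κ, ‖A x κ‖ ≤ a) (hζ0 : |ζ z| ≤ 1) :
    ‖locB ζ L ((η : ℂ) • A) j z μ‖ ≤ 2 * a * ((L : ℝ) ^ j * ((L : ℝ) ^ n)⁻¹) := by
  have hL1 : 1 ≤ L := le_trans (by norm_num) hL
  have hL0 : (0 : ℝ) < L := by exact_mod_cast lt_of_lt_of_le (by norm_num) hL
  rw [← locB_clamp_eq ζ L hL1 A j z μ η hblk]
  -- the clamped field has the global letter
  have hA' := clamp_sup hbox A hA
  have hηpos : 0 < η := by rw [hη]; positivity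
  have hηn : ‖(η : ℂ)‖ = η := by rw [Complex.norm_real, Real.norm_of_nonneg hηpos.le]
  have hB : ∀ y κ, ‖((η : ℂ) • fun (x : B7Prop1Explicit.Site d) (κ : Fin d) => A (fun i => max (lo i) (min (x i) (hi i))) κ) y κ‖ ≤ η * a :=
    fun y κ => by
    rw [Pi.smul_apply, Pi.smul_apply, norm_smul, hηn]
    exact mul_le_mul_of_nonneg_left (hA' y κ) hηpos.le
  have hQ := norm_logIter_le L hL _ j (by positivity) hk hB z μ
  rw [locB, norm_smul, Real.norm_eq_abs]
  calc |ζ z| * ‖B7Prop4Flat.logIter L ((η : ℂ) • fun (x : B7Prop1Explicit.Site d) (κ : Fin d) => A (fun i => max (lo i) (min (x i) (hi i))) κ) j z μ‖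
      ≤ 1 * (2 * ((L : ℝ) ^ j * (η * a))) := mul_le_mul hζ0 hQ (norm_nonneg _) zero_le_one
    _ = 2 * a * ((L : ℝ) ^ j * ((L : ℝ) ^ n)⁻¹) := by rw [hη]; ring

/-- **(I.4.17) «with η replaced by L⁻ⁿ» under LOCAL hypotheses**: `‖(∂_νB_μ)(z)‖ ≤ (2c₁a + 4da′)·(LʲL⁻ⁿ)²` when the
(2.38)-shaped letters of `A` (`‖A‖ ≤ a`, fine `ν`-differences `≤ L⁻ⁿa′`) hold ON A BOX `[lo, hi]` containing the blocks of
`(z, μ)` and `(z + e_ν, μ)` — print: (2.38) «on □∩X» — by the clamping retraction (which keeps both letters globally)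
and `…B12Ineq417Flat.ineq417_flat_scaled` BY NAME at `η := (Lⁿ)⁻¹`.
[cite: Balaban1988Convergent, (2.38) p.261, p.276; Balaban1987RG1, (4.17) p.285] -/
theorem ineq417_scaleN_local (ζ : B7Prop1Explicit.Site d → ℝ) (L : ℕ) (hL : 2 ≤ L)
    (A : B7Prop1Explicit.Site d → Fin d → 𝔸) (j n : ℕ) (ν : Fin d) (z : B7Prop1Explicit.Site d) (μ : Fin d)
    {η a a' c₁ : ℝ} (hη : η = ((L : ℝ) ^ n)⁻¹) (ha : 0 ≤ a) (ha' : 0 ≤ a')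
    (hk : C3 d L * ((L : ℝ) ^ j * (η * a)) ≤ 1)
    {lo hi : B7Prop1Explicit.Site d} (hbox : ∀ i, lo i ≤ hi i)
    (hblk : ∀ i, lo i ≤ loK L j z i ∧ bondHiK L j z μ i ≤ hi i)
    (hblk' : ∀ i, lo i ≤ loK L j (z + e ν) i ∧ bondHiK L j (z + e ν) μ i ≤ hi i)
    (hA : ∀ x, InBox lo hi x → ∀ κ, ‖A x κ‖ ≤ a)
    (hA' : ∀ x, InBox lo hi x → InBox lo hi (x + e ν) → ∀ κ, ‖A (x + e ν) κ - A x κ‖ ≤ η * a')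
    (hζ0 : |ζ z| ≤ 1) (hζ1 : |ζ (z + e ν) - ζ z| ≤ c₁ * ((L : ℝ) ^ j * η)) :
    ‖dlocB ζ L ((η : ℂ) • A) j ν z μ‖ ≤ (2 * c₁ * a + 4 * d * a') * ((L : ℝ) ^ j * ((L : ℝ) ^ n)⁻¹) ^ 2 := by
  have hL1 : 1 ≤ L := le_trans (by norm_num) hL
  have hL0 : (0 : ℝ) < L := by exact_mod_cast lt_of_lt_of_le (by norm_num) hL
  have hηpos : 0 < η := by rw [hη]; positivity
  -- pass to the clamped field on both coarse bonds
  unfold dlocB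
  rw [← locB_clamp_eq ζ L hL1 A j z μ η hblk, ← locB_clamp_eq ζ L hL1 A j (z + e ν) μ η hblk']
  have hAc := clamp_sup hbox A hA
  have hAc' := clamp_diff hbox A ν (by positivity : 0 ≤ η * a') hA'
  have h := ineq417_flat_scaled ζ L hL (fun (x : B7Prop1Explicit.Site d) (κ : Fin d) => A (fun i => max (lo i) (min (x i) (hi i))) κ) j ν z μ hηpos ha
    hk hAc hAc' hζ0 hζ1
  unfold dlocB at h
  rw [← hη]
  refine h.trans (mul_le_mul_of_nonneg_right ?_ (sq_nonneg _))
  have h2 : 2 * (d : ℝ) * (1 + C3 d L * ((L : ℝ) ^ j * (η * a))) * a' ≤ 2 * d * 2 * a' := by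
    have : 1 + C3 d L * ((L : ℝ) ^ j * (η * a)) ≤ 2 := by linarith
    have hd : (0 : ℝ) ≤ 2 * d := by positivity
    nlinarith [mul_nonneg hd ha']
  linarith

end Local

/-! ## §3. (I.4.18) with the Hölder letter assumed only on the fine box of `z` -/

section Local418

variable {𝔸 : Type*} [NormedRing 𝔸] [NormedAlgebra ℂ 𝔸] [CompleteSpace 𝔸]

omit [NormedAlgebra ℂ 𝔸] [CompleteSpace 𝔸] in
/-- `sup ‖·‖ ≤ m` passes to the restriction (sup norm of `𝔸^S`). [folklore] -/
private theorem norm_restr_le' {S : Finset (B7Prop1Explicit.Site d × Fin d)} {F : B7Prop1Explicit.Site d → Fin d → 𝔸}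
    {m : ℝ} (hm : 0 ≤ m) (hF : ∀ x κ, ‖F x κ‖ ≤ m) : ‖restr S F‖ ≤ m :=
  (pi_norm_le_iff_of_nonneg hm).2 fun s => hF s.1.1 s.1.2

omit [NormedAlgebra ℂ 𝔸] [CompleteSpace 𝔸] in
/-- **Size of the double difference, LOCAL form** of `…B12Ineq418Flat.norm_dd2Cfg_le`: the coarse variation of the fine
`ν`-gradient across `a` assumed only at the `n` base points `x′ + me_ν`, `m < n`, of the segment gives
`‖(t_{a+ne_ν}B − t_aB − t_{ne_ν}B + B)(x′)‖ ≤ n·g₂`. [cite: Balaban1987RG1, (4.18) p.285] (elementary API; our proof) -/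
theorem norm_dd2Cfg_le_local (a : B7Prop1Explicit.Site d) (n : ℕ) (ν : Fin d)
    (B : B7Prop1Explicit.Site d → Fin d → 𝔸) (x : B7Prop1Explicit.Site d) (κ : Fin d) {g₂ : ℝ}
    (hg₂ : ∀ m < n, ‖(B (x + a + (m : ℤ) • e ν + e ν) κ - B (x + a + (m : ℤ) • e ν) κ)
      - (B (x + (m : ℤ) • e ν + e ν) κ - B (x + (m : ℤ) • e ν) κ)‖ ≤ g₂) :
    ‖dd2Cfg a ((n : ℤ) • e ν) B x κ‖ ≤ n * g₂ := by
  rw [dd2Cfg_eq_sum]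
  refine (norm_sum_le _ _).trans ?_
  calc ∑ m ∈ Finset.range n, ‖(B (x + a + (m : ℤ) • e ν + e ν) κ - B (x + a + (m : ℤ) • e ν) κ)
            - (B (x + (m : ℤ) • e ν + e ν) κ - B (x + (m : ℤ) • e ν) κ)‖
      ≤ ∑ _m ∈ Finset.range n, g₂ := Finset.sum_le_sum fun m hm => hg₂ m (Finset.mem_range.mp hm)
    _ = n * g₂ := by simp

/-- **The mixed second difference of `Q_j(1, ·)`, Hölder letter LOCAL**: as `…B12Ineq418Flat.norm_secondDiff_logIter_le`
(whose proof — translation covariance, Prop. 5 of [7] in operator form, two one-variable Cauchy estimates — is REPEATED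
here verbatim), but the coarse variation of the fine `ν`-gradient across `Lʲe_λ` (the Hölder member of (I.3.32)) is
assumed only at the base points `y` of the fine box `[Lʲz, Lʲz + (Lʲ−1)𝟙 + Lʲe_μ + (Lʲ−1)e_ν]` — the only points that
proof uses (through the restriction of the double difference to the bonds of the box of `z`).
[cite: Balaban1987RG1, (4.18) p.285; Balaban1985Averaging, Prop. 4 p.38, Prop. 5 (156) p.42] -/
theorem norm_secondDiff_logIter_le_local (L : ℕ) (hL : 2 ≤ L) (B : B7Prop1Explicit.Site d → Fin d → 𝔸) (j : ℕ)
    (lam ν : Fin d) (z : B7Prop1Explicit.Site d) (μ : Fin d) {b b₁ g g₂ r : ℝ} (hb : 0 ≤ b) (hg : 0 ≤ g)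
    (hg₂ : 0 ≤ g₂) (hr : 0 < r) (hk : C3 d L * ((L : ℝ) ^ j * b₁) ≤ 1) (hroom : b + 2 * ((L : ℝ) ^ j * g) + 2 * r ≤ b₁)
    (hB : ∀ x κ, ‖B x κ‖ ≤ b) (hgLam : ∀ x κ, ‖B (x + e lam) κ - B x κ‖ ≤ g)
    (hgν : ∀ x κ, ‖B (x + e ν) κ - B x κ‖ ≤ g)
    (hG : ∀ y, InBox (loK L j z) (bondHiK L j z μ + (((L : ℤ) ^ j - 1) • e ν)) y → ∀ κ,
      ‖(B (y + ((L : ℤ) ^ j) • e lam + e ν) κ - B (y + ((L : ℤ) ^ j) • e lam) κ) - (B (y + e ν) κ - B y κ)‖ ≤ g₂) :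
    ‖logIter L B j (z + e lam + e ν) μ - logIter L B j (z + e lam) μ - logIter L B j (z + e ν) μ + logIter L B j z μ‖
      ≤ 2 * d * (L : ℝ) ^ j * (1 + C3 d L * ((L : ℝ) ^ j * b₁)) * ((L : ℝ) ^ j * g₂)
        + 2 * ((L : ℝ) ^ j * b₁) * ((L : ℝ) ^ j * g) * ((L : ℝ) ^ j * g) / r ^ 2 := by
  have hL1 : 1 ≤ L := le_trans (by norm_num) hL
  have hLj : (0 : ℝ) ≤ (L : ℝ) ^ j := by positivity
  have hLg : 0 ≤ (L : ℝ) ^ j * g := mul_nonneg hLj hg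
  have hb₁ : b ≤ b₁ := by linarith
  have hb₁0 : 0 ≤ b₁ := hb.trans hb₁
  have hC3 := C3_pos d L hL1
  -- the index set, the two translations and the four points of `𝔸^S`
  set S := boxBonds L j z μ with hS
  set aLam : B7Prop1Explicit.Site d := ((L : ℤ) ^ j) • e lam with haLam
  set aNu : B7Prop1Explicit.Site d := ((L : ℤ) ^ j) • e ν with haNu
  set p : S → 𝔸 := restr S B with hp
  set V : S → 𝔸 := restr S (shiftCfg aLam B) - p with hV
  set W : S → 𝔸 := restr S (shiftCfg aNu B) - p with hW
  set Z : S → 𝔸 := restr S (shiftCfg (aLam + aNu) B) - (p + V + W) with hZ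
  have hpV : p + V = restr S (shiftCfg aLam B) := by rw [hV]; abel
  have hpW : p + W = restr S (shiftCfg aNu B) := by rw [hW]; abel
  have hpVWZ : p + V + W + Z = restr S (shiftCfg (aLam + aNu) B) := by rw [hZ]; abel
  have hVeq : V = restr S (shiftCfg aLam B - B) := by rw [hV, hp]; funext s; simp [restr]
  have hWeq : W = restr S (shiftCfg aNu B - B) := by rw [hW, hp]; funext s; simp [restr]
  have hZeq : Z = restr S (dd2Cfg aLam aNu B) := by
    rw [hZ, hV, hW, hp]; funext s; simp [restr, dd2Cfg]; abel
  rw [secondDiff_logIter_eq L hL1 B j lam ν z μ p V W Z hp hpV hpW hpVWZ]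
  -- sizes of the restricted vectors
  have hmLam : ∀ x κ, ‖(shiftCfg aLam B - B) x κ‖ ≤ (L : ℝ) ^ j * g := by
    intro x κ
    have h := norm_shiftCfg_sub_le lam (fun y => B y κ) (fun y => hgLam y κ) (L ^ j) x
    have hcast : (((L ^ j : ℕ) : ℤ)) • e lam = aLam := by rw [haLam]; push_cast; rfl
    rw [hcast] at h
    simpa [shiftCfg] using h
  have hmν : ∀ x κ, ‖(shiftCfg aNu B - B) x κ‖ ≤ (L : ℝ) ^ j * g := by
    intro x κ
    have h := norm_shiftCfg_sub_le ν (fun y => B y κ) (fun y => hgν y κ) (L ^ j) x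
    have hcast : (((L ^ j : ℕ) : ℤ)) • e ν = aNu := by rw [haNu]; push_cast; rfl
    rw [hcast] at h
    simpa [shiftCfg] using h
  -- the LOCAL step: the double difference is needed only at the sites of the bonds of `S`
  have hmZ : ∀ s : S, ‖dd2Cfg aLam aNu B s.1.1 s.1.2‖ ≤ (L : ℝ) ^ j * g₂ := by
    intro s
    have hs : InBox (loK L j z) (bondHiK L j z μ) s.1.1 := ((mem_bondsIn.mp s.2).1)
    have h := norm_dd2Cfg_le_local aLam (L ^ j) ν B s.1.1 s.1.2 (g₂ := g₂) (fun m hm => by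
      have hmL : (m : ℤ) ≤ (L : ℤ) ^ j - 1 := by
        have h1 : (m : ℤ) < ((L ^ j : ℕ) : ℤ) := by exact_mod_cast hm
        have h2 : ((L ^ j : ℕ) : ℤ) = (L : ℤ) ^ j := by push_cast; rfl
        omega
      have hy : InBox (loK L j z) (bondHiK L j z μ + (((L : ℤ) ^ j - 1) • e ν)) (s.1.1 + (m : ℤ) • e ν) := by
        intro i
        obtain ⟨h1, h2⟩ := hs i
        simp only [Pi.add_apply, Pi.smul_apply, B7Prop1Explicit.e_apply, smul_eq_mul, mul_ite, mul_one, mul_zero]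
        constructor
        · split_ifs <;> omega
        · split_ifs <;> omega
      have h' := hG _ hy s.1.2
      rwa [add_right_comm s.1.1 ((m : ℤ) • e ν) aLam] at h')
    have hcast : (((L ^ j : ℕ) : ℤ)) • e ν = aNu := by rw [haNu]; push_cast; rfl
    rw [hcast] at h
    simpa using h
  have hVn : ‖V‖ ≤ (L : ℝ) ^ j * g := by rw [hVeq]; exact norm_restr_le' hLg hmLam
  have hWn : ‖W‖ ≤ (L : ℝ) ^ j * g := by rw [hWeq]; exact norm_restr_le' hLg hmν
  have hZn : ‖Z‖ ≤ (L : ℝ) ^ j * g₂ := by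
    rw [hZeq]
    exact (pi_norm_le_iff_of_nonneg (mul_nonneg hLj hg₂)).2 fun s => hmZ s
  have hpn : ‖p‖ ≤ b := norm_restr_le' hb hB
  -- (i) the first bracket: mean value inequality with Prop. 5 in operator form on the closed polydisc of radius `b₁`
  have hK : Convex ℝ {y : S → 𝔸 | ∀ s, ‖y s‖ ≤ b₁} := by
    intro y hy y' hy' s t hs ht hst i
    calc ‖(s • y + t • y') i‖ = ‖s • y i + t • y' i‖ := rfl
      _ ≤ ‖s • y i‖ + ‖t • y' i‖ := norm_add_le _ _
      _ = s * ‖y i‖ + t * ‖y' i‖ := by rw [norm_smul, norm_smul, Real.norm_of_nonneg hs, Real.norm_of_nonneg ht]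
      _ ≤ s * b₁ + t * b₁ := add_le_add (mul_le_mul_of_nonneg_left (hy i) hs) (mul_le_mul_of_nonneg_left (hy' i) ht)
      _ = b₁ := by rw [← add_mul, hst, one_mul]
  have hmemVW : p + V + W ∈ {y : S → 𝔸 | ∀ s, ‖y s‖ ≤ b₁} := by
    intro s
    calc ‖(p + V + W) s‖ ≤ ‖p + V + W‖ := norm_le_pi_norm _ s
      _ ≤ ‖p‖ + ‖V‖ + ‖W‖ := (norm_add_le _ _).trans (add_le_add (norm_add_le _ _) le_rfl)
      _ ≤ b + (L : ℝ) ^ j * g + (L : ℝ) ^ j * g := by linarith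
      _ ≤ b₁ := by linarith
  have hmemVWZ : p + V + W + Z ∈ {y : S → 𝔸 | ∀ s, ‖y s‖ ≤ b₁} := by
    intro s
    rw [hpVWZ]
    simpa [restr, shiftCfg] using (hB (s.1.1 + (aLam + aNu)) s.1.2).trans hb₁
  have hdiffK : ∀ y ∈ {y : S → 𝔸 | ∀ s, ‖y s‖ ≤ b₁}, DifferentiableAt ℝ (avgMap L S (oneBond z μ) j) y :=
    fun y hy => differentiableAt_avgMap_real L hL S (oneBond z μ) j hb₁0 hk hy
  have hboundK : ∀ y ∈ {y : S → 𝔸 | ∀ s, ‖y s‖ ≤ b₁},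
      ‖fderiv ℝ (avgMap L S (oneBond z μ) j) y‖ ≤ 2 * d * (L : ℝ) ^ j * (1 + C3 d L * ((L : ℝ) ^ j * b₁)) :=
    fun y hy => opNorm_fderiv_real_avgMap_le L hL S (oneBond z μ) j hb₁0 hk hy
  have hmvt := hK.norm_image_sub_le_of_norm_fderiv_le hdiffK hboundK hmemVW hmemVWZ
  have hD0 : 0 ≤ 2 * d * (L : ℝ) ^ j * (1 + C3 d L * ((L : ℝ) ^ j * b₁)) := by positivity
  have hfirst : ‖avgMap L S (oneBond z μ) j (p + V + W + Z) (theBond z μ)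
        - avgMap L S (oneBond z μ) j (p + V + W) (theBond z μ)‖
      ≤ 2 * d * (L : ℝ) ^ j * (1 + C3 d L * ((L : ℝ) ^ j * b₁)) * ((L : ℝ) ^ j * g₂) := by
    calc ‖avgMap L S (oneBond z μ) j (p + V + W + Z) (theBond z μ) - avgMap L S (oneBond z μ) j (p + V + W) (theBond z μ)‖
        = ‖(avgMap L S (oneBond z μ) j (p + V + W + Z) - avgMap L S (oneBond z μ) j (p + V + W)) (theBond z μ)‖ := rfl
      _ ≤ ‖avgMap L S (oneBond z μ) j (p + V + W + Z) - avgMap L S (oneBond z μ) j (p + V + W)‖ := norm_le_pi_norm _ _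
      _ ≤ 2 * d * (L : ℝ) ^ j * (1 + C3 d L * ((L : ℝ) ^ j * b₁)) * ‖p + V + W + Z - (p + V + W)‖ := hmvt
      _ = 2 * d * (L : ℝ) ^ j * (1 + C3 d L * ((L : ℝ) ^ j * b₁)) * ‖Z‖ := by rw [add_sub_cancel_left]
      _ ≤ 2 * d * (L : ℝ) ^ j * (1 + C3 d L * ((L : ℝ) ^ j * b₁)) * ((L : ℝ) ^ j * g₂) :=
          mul_le_mul_of_nonneg_left hZn hD0
  -- (ii) the second bracket: the Cauchy square on the OPEN polydisc of radius `b₁`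
  have hU : IsOpen {y : S → 𝔸 | ∀ s, ‖y s‖ < b₁} := B7Prop4Flat.isOpen_polydisc S b₁
  have hfU : DifferentiableOn ℂ (fun q : S → 𝔸 => avgMap L S (oneBond z μ) j q (theBond z μ))
      {y : S → 𝔸 | ∀ s, ‖y s‖ < b₁} := fun y hy =>
    (analyticAt_avgMap_apply L hL S (oneBond z μ) j hb₁0 hk (fun s => (hy s).le) (theBond z μ)).differentiableAt
      |>.differentiableWithinAt
  have hMU : ∀ q ∈ {y : S → 𝔸 | ∀ s, ‖y s‖ < b₁}, ‖avgMap L S (oneBond z μ) j q (theBond z μ)‖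
      ≤ 2 * ((L : ℝ) ^ j * b₁) := by
    intro q hq
    have hins : ∀ x κ, ‖insCfg S q x κ‖ ≤ b₁ := norm_insCfg_le_of_le hb₁0 fun s => (hq s).le
    simpa [avgMap_apply, theBond] using norm_logIter_le L hL (insCfg S q) j hb₁0 hk hins z μ
  have hmem : ∀ s t : ℂ, ‖s‖ * ‖V‖ < ‖V‖ + r → ‖t‖ * ‖W‖ < ‖W‖ + r →
      p + s • V + t • W ∈ {y : S → 𝔸 | ∀ s, ‖y s‖ < b₁} := by
    intro s t hs ht i
    calc ‖(p + s • V + t • W) i‖ ≤ ‖p + s • V + t • W‖ := norm_le_pi_norm _ i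
      _ ≤ ‖p‖ + ‖s • V‖ + ‖t • W‖ := (norm_add_le _ _).trans (add_le_add (norm_add_le _ _) le_rfl)
      _ = ‖p‖ + ‖s‖ * ‖V‖ + ‖t‖ * ‖W‖ := by rw [norm_smul, norm_smul]
      _ < b + ((L : ℝ) ^ j * g + r) + ((L : ℝ) ^ j * g + r) := by
          have h1 : ‖s‖ * ‖V‖ < (L : ℝ) ^ j * g + r := lt_of_lt_of_le hs (by linarith)
          have h2 : ‖t‖ * ‖W‖ < (L : ℝ) ^ j * g + r := lt_of_lt_of_le ht (by linarith)
          linarith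
      _ ≤ b₁ := by linarith
  have hsecond := norm_secondDiff_le hU hfU (by positivity : (0 : ℝ) ≤ 2 * ((L : ℝ) ^ j * b₁)) hr p V W hmem hMU
  have hsecond' : ‖avgMap L S (oneBond z μ) j (p + V + W) (theBond z μ) - avgMap L S (oneBond z μ) j (p + V) (theBond z μ)
        - avgMap L S (oneBond z μ) j (p + W) (theBond z μ) + avgMap L S (oneBond z μ) j p (theBond z μ)‖
      ≤ 2 * ((L : ℝ) ^ j * b₁) * ((L : ℝ) ^ j * g) * ((L : ℝ) ^ j * g) / r ^ 2 := by
    refine hsecond.trans ?_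
    have : 2 * ((L : ℝ) ^ j * b₁) * ‖V‖ * ‖W‖ ≤ 2 * ((L : ℝ) ^ j * b₁) * ((L : ℝ) ^ j * g) * ((L : ℝ) ^ j * g) := by
      have h1 : 2 * ((L : ℝ) ^ j * b₁) * ‖V‖ ≤ 2 * ((L : ℝ) ^ j * b₁) * ((L : ℝ) ^ j * g) :=
        mul_le_mul_of_nonneg_left hVn (by positivity)
      exact mul_le_mul h1 hWn (norm_nonneg _) (by positivity)
    exact div_le_div_of_nonneg_right this (by positivity)
  exact (norm_add_le _ _).trans (add_le_add hfirst hsecond')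

/-- **(I.4.18) at the flat background, Hölder letter LOCAL** — `…B12Ineq418Flat.ineq418_flat` (product-rule assembly
repeated verbatim) with `hG` assumed only on the fine box `[Lʲz, Lʲz + (Lʲ−1)𝟙 + Lʲe_μ + (Lʲ−1)e_ν]`.
[cite: Balaban1987RG1, (4.18) p.285; Balaban1985Averaging, Prop. 4 p.38, Prop. 5 (156) p.42] -/
theorem ineq418_flat_local (ζ : B7Prop1Explicit.Site d → ℝ) (L : ℕ) (hL : 2 ≤ L)
    (B : B7Prop1Explicit.Site d → Fin d → 𝔸) (j : ℕ) (lam ν : Fin d) (z : B7Prop1Explicit.Site d) (μ : Fin d)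
    {b b₁ g g₂ r δ₁ δ₂ : ℝ} (hb : 0 ≤ b) (hg : 0 ≤ g) (hg₂ : 0 ≤ g₂) (hr : 0 < r)
    (hk : C3 d L * ((L : ℝ) ^ j * b₁) ≤ 1) (hroom : b + 2 * ((L : ℝ) ^ j * g) + 2 * r ≤ b₁)
    (hB : ∀ x κ, ‖B x κ‖ ≤ b) (hgLam : ∀ x κ, ‖B (x + e lam) κ - B x κ‖ ≤ g)
    (hgν : ∀ x κ, ‖B (x + e ν) κ - B x κ‖ ≤ g)
    (hG : ∀ y, InBox (loK L j z) (bondHiK L j z μ + (((L : ℤ) ^ j - 1) • e ν)) y → ∀ κ,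
      ‖(B (y + ((L : ℤ) ^ j) • e lam + e ν) κ - B (y + ((L : ℤ) ^ j) • e lam) κ) - (B (y + e ν) κ - B y κ)‖ ≤ g₂)
    (hζ0 : |ζ z| ≤ 1) (hζLam : |ζ (z + e lam) - ζ z| ≤ δ₁) (hζν : |ζ (z + e ν) - ζ z| ≤ δ₁)
    (hζ2 : |ζ (z + e lam + e ν) - ζ (z + e lam) - ζ (z + e ν) + ζ z| ≤ δ₂) :
    ‖ddlocB ζ L B j lam ν z μ‖
      ≤ (2 * d * (L : ℝ) ^ j * (1 + C3 d L * ((L : ℝ) ^ j * b₁)) * ((L : ℝ) ^ j * g₂)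
          + 2 * ((L : ℝ) ^ j * b₁) * ((L : ℝ) ^ j * g) * ((L : ℝ) ^ j * g) / r ^ 2)
        + 2 * (δ₁ * (2 * d * (L : ℝ) ^ j * (1 + C3 d L * ((L : ℝ) ^ j * b)) * ((L : ℝ) ^ j * g)))
        + δ₂ * (2 * ((L : ℝ) ^ j * b)) := by
  have hL1 : 1 ≤ L := le_trans (by norm_num) hL
  have hC3 := C3_pos d L hL1
  have hLj : (0 : ℝ) ≤ (L : ℝ) ^ j := by positivity
  have hLg : 0 ≤ (L : ℝ) ^ j * g := mul_nonneg hLj hg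
  have hb₁ : b ≤ b₁ := by linarith
  have hkb : C3 d L * ((L : ℝ) ^ j * b) ≤ 1 :=
    (mul_le_mul_of_nonneg_left (mul_le_mul_of_nonneg_left hb₁ hLj) hC3.le).trans hk
  -- fine differences of the translated fields
  have hmν : ∀ x κ, ‖shiftCfg (((L : ℤ) ^ j) • e ν) B x κ - B x κ‖ ≤ (L : ℝ) ^ j * g := by
    intro x κ
    have h := norm_shiftCfg_sub_le ν (fun y => B y κ) (fun y => hgν y κ) (L ^ j) x
    have hcast : (((L ^ j : ℕ) : ℤ)) • e ν = ((L : ℤ) ^ j) • e ν := by push_cast; rfl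
    rw [hcast] at h
    simpa [shiftCfg] using h
  have hmLam : ∀ x κ, ‖shiftCfg (((L : ℤ) ^ j) • e lam) B x κ - B x κ‖ ≤ (L : ℝ) ^ j * g := by
    intro x κ
    have h := norm_shiftCfg_sub_le lam (fun y => B y κ) (fun y => hgLam y κ) (L ^ j) x
    have hcast : (((L ^ j : ℕ) : ℤ)) • e lam = ((L : ℤ) ^ j) • e lam := by push_cast; rfl
    rw [hcast] at h
    simpa [shiftCfg] using h
  -- `Q(z+e_λ+e_ν) − Q(z+e_λ)`: a coarse `ν`-step at the translated field `t_{a_λ}B`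
  have hDν : ‖logIter L B j (z + e lam + e ν) μ - logIter L B j (z + e lam) μ‖
      ≤ 2 * d * (L : ℝ) ^ j * (1 + C3 d L * ((L : ℝ) ^ j * b)) * ((L : ℝ) ^ j * g) := by
    have hBLam : ∀ x κ, ‖shiftCfg (((L : ℤ) ^ j) • e lam) B x κ‖ ≤ b := fun x κ => by simpa [shiftCfg] using hB _ κ
    have hmν' : ∀ x κ, ‖shiftCfg (((L : ℤ) ^ j) • e ν) (shiftCfg (((L : ℤ) ^ j) • e lam) B) x κ
        - shiftCfg (((L : ℤ) ^ j) • e lam) B x κ‖ ≤ (L : ℝ) ^ j * g := fun x κ => by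
      have h := hmν (x + ((L : ℤ) ^ j) • e lam) κ
      simp only [shiftCfg_apply] at h ⊢
      rwa [add_right_comm x (((L : ℤ) ^ j) • e ν) (((L : ℤ) ^ j) • e lam)]
    have h := norm_logIter_shift_sub_le L hL (shiftCfg (((L : ℤ) ^ j) • e lam) B) j hb hkb hBLam
      (((L : ℤ) ^ j) • e ν) hmν' z μ
    have e10 : logIter L B j (z + e lam) μ = logIter L (shiftCfg (((L : ℤ) ^ j) • e lam) B) j z μ :=
      logIter_shiftCfg L B j (e lam) z μ
    have e11 : logIter L B j (z + e lam + e ν) μ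
        = logIter L (shiftCfg (((L : ℤ) ^ j) • e ν) (shiftCfg (((L : ℤ) ^ j) • e lam) B)) j z μ := by
      rw [add_right_comm z (e lam) (e ν), logIter_shiftCfg L B j (e lam) (z + e ν) μ,
        logIter_shiftCfg L (shiftCfg (((L : ℤ) ^ j) • e lam) B) j (e ν) z μ]
    rw [e11, e10]; exact h
  -- `Q(z+e_λ+e_ν) − Q(z+e_ν)`: a coarse `λ`-step at the translated field `t_{a_ν}B`
  have hDLam : ‖logIter L B j (z + e lam + e ν) μ - logIter L B j (z + e ν) μ‖
      ≤ 2 * d * (L : ℝ) ^ j * (1 + C3 d L * ((L : ℝ) ^ j * b)) * ((L : ℝ) ^ j * g) := by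
    have hBν : ∀ x κ, ‖shiftCfg (((L : ℤ) ^ j) • e ν) B x κ‖ ≤ b := fun x κ => by simpa [shiftCfg] using hB _ κ
    have hmLam' : ∀ x κ, ‖shiftCfg (((L : ℤ) ^ j) • e lam) (shiftCfg (((L : ℤ) ^ j) • e ν) B) x κ
        - shiftCfg (((L : ℤ) ^ j) • e ν) B x κ‖ ≤ (L : ℝ) ^ j * g := fun x κ => by
      have h := hmLam (x + ((L : ℤ) ^ j) • e ν) κ
      simp only [shiftCfg_apply] at h ⊢
      rwa [add_right_comm x (((L : ℤ) ^ j) • e lam) (((L : ℤ) ^ j) • e ν)]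
    have h := norm_logIter_shift_sub_le L hL (shiftCfg (((L : ℤ) ^ j) • e ν) B) j hb hkb hBν
      (((L : ℤ) ^ j) • e lam) hmLam' z μ
    have e01 : logIter L B j (z + e ν) μ = logIter L (shiftCfg (((L : ℤ) ^ j) • e ν) B) j z μ :=
      logIter_shiftCfg L B j (e ν) z μ
    have e11 : logIter L B j (z + e lam + e ν) μ
        = logIter L (shiftCfg (((L : ℤ) ^ j) • e lam) (shiftCfg (((L : ℤ) ^ j) • e ν) B)) j z μ := by
      rw [logIter_shiftCfg L B j (e ν) (z + e lam) μ, logIter_shiftCfg L (shiftCfg (((L : ℤ) ^ j) • e ν) B) j (e lam) z μ]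
    rw [e11, e01]; exact h
  have hQ11 : ‖logIter L B j (z + e lam + e ν) μ‖ ≤ 2 * ((L : ℝ) ^ j * b) := norm_logIter_le L hL B j hb hkb hB _ μ
  have hmain := norm_secondDiff_logIter_le_local L hL B j lam ν z μ hb hg hg₂ hr hk hroom hB hgLam hgν hG
  -- assemble with the product rule
  rw [eq418_split]
  have hA : ‖ζ z • (logIter L B j (z + e lam + e ν) μ - logIter L B j (z + e lam) μ - logIter L B j (z + e ν) μ
        + logIter L B j z μ)‖
      ≤ 2 * d * (L : ℝ) ^ j * (1 + C3 d L * ((L : ℝ) ^ j * b₁)) * ((L : ℝ) ^ j * g₂)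
        + 2 * ((L : ℝ) ^ j * b₁) * ((L : ℝ) ^ j * g) * ((L : ℝ) ^ j * g) / r ^ 2 := by
    rw [norm_smul, Real.norm_eq_abs]
    exact (mul_le_mul hζ0 hmain (norm_nonneg _) zero_le_one).trans_eq (one_mul _)
  have hBterm : ‖(ζ (z + e lam) - ζ z) • (logIter L B j (z + e lam + e ν) μ - logIter L B j (z + e lam) μ)‖
      ≤ δ₁ * (2 * d * (L : ℝ) ^ j * (1 + C3 d L * ((L : ℝ) ^ j * b)) * ((L : ℝ) ^ j * g)) := by
    rw [norm_smul, Real.norm_eq_abs]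
    exact mul_le_mul hζLam hDν (norm_nonneg _) ((abs_nonneg _).trans hζLam)
  have hCterm : ‖(ζ (z + e ν) - ζ z) • (logIter L B j (z + e lam + e ν) μ - logIter L B j (z + e ν) μ)‖
      ≤ δ₁ * (2 * d * (L : ℝ) ^ j * (1 + C3 d L * ((L : ℝ) ^ j * b)) * ((L : ℝ) ^ j * g)) := by
    rw [norm_smul, Real.norm_eq_abs]
    exact mul_le_mul hζν hDLam (norm_nonneg _) ((abs_nonneg _).trans hζν)
  have hDterm : ‖(ζ (z + e lam + e ν) - ζ (z + e lam) - ζ (z + e ν) + ζ z) • logIter L B j (z + e lam + e ν) μ‖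
      ≤ δ₂ * (2 * ((L : ℝ) ^ j * b)) := by
    rw [norm_smul, Real.norm_eq_abs]
    exact mul_le_mul hζ2 hQ11 (norm_nonneg _) ((abs_nonneg _).trans hζ2)
  calc _ ≤ (2 * d * (L : ℝ) ^ j * (1 + C3 d L * ((L : ℝ) ^ j * b₁)) * ((L : ℝ) ^ j * g₂)
          + 2 * ((L : ℝ) ^ j * b₁) * ((L : ℝ) ^ j * g) * ((L : ℝ) ^ j * g) / r ^ 2)
        + δ₁ * (2 * d * (L : ℝ) ^ j * (1 + C3 d L * ((L : ℝ) ^ j * b)) * ((L : ℝ) ^ j * g))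
        + δ₁ * (2 * d * (L : ℝ) ^ j * (1 + C3 d L * ((L : ℝ) ^ j * b)) * ((L : ℝ) ^ j * g))
        + δ₂ * (2 * ((L : ℝ) ^ j * b)) :=
        norm_add_le_of_le (norm_add_le_of_le (norm_add_le_of_le hA hBterm) hCterm) hDterm
    _ = _ := by ring

/-- **(I.4.18), the printed `(Lʲη)^{2+β}` law with `θ` for `(Lʲη)^β`, Hölder letter LOCAL** —
`…B12Ineq418Flat.ineq418_flat_scaled` (its radius/margin arithmetic repeated verbatim) with `hA2` assumed only on the fine
box `[Lʲz, Lʲz + (Lʲ−1)𝟙 + Lʲe_μ + (Lʲ−1)e_ν]`. [cite: Balaban1987RG1, (4.18) p.285] -/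
theorem ineq418_flat_scaled_local (ζ : B7Prop1Explicit.Site d → ℝ) (L : ℕ) (hL : 2 ≤ L)
    (A : B7Prop1Explicit.Site d → Fin d → 𝔸) (j : ℕ) (lam ν : Fin d) (z : B7Prop1Explicit.Site d) (μ : Fin d)
    {η a a' a'' θ c₁ c₂ : ℝ} (hη : 0 < η) (ha : 0 ≤ a) (ha' : 0 ≤ a') (ha'' : 0 ≤ a'')
    (hθx : (L : ℝ) ^ j * η ≤ θ) (hθ1 : θ ≤ 1)
    (hsmall : C3 d L * ((L : ℝ) ^ j * η * (2 * a + 4 * ((L : ℝ) ^ j * η) * a')) ≤ 1)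
    (hA : ∀ x κ, ‖A x κ‖ ≤ a) (hALam : ∀ x κ, ‖A (x + e lam) κ - A x κ‖ ≤ η * a')
    (hAν : ∀ x κ, ‖A (x + e ν) κ - A x κ‖ ≤ η * a')
    (hA2 : ∀ y, InBox (loK L j z) (bondHiK L j z μ + (((L : ℤ) ^ j - 1) • e ν)) y → ∀ κ,
      ‖(A (y + ((L : ℤ) ^ j) • e lam + e ν) κ - A (y + ((L : ℤ) ^ j) • e lam) κ) - (A (y + e ν) κ - A y κ)‖
        ≤ η * (a'' * θ))
    (hζ0 : |ζ z| ≤ 1) (hζLam : |ζ (z + e lam) - ζ z| ≤ c₁ * ((L : ℝ) ^ j * η))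
    (hζν : |ζ (z + e ν) - ζ z| ≤ c₁ * ((L : ℝ) ^ j * η))
    (hζ2 : |ζ (z + e lam + e ν) - ζ (z + e lam) - ζ (z + e ν) + ζ z| ≤ c₂ * ((L : ℝ) ^ j * η) ^ 2) :
    ‖ddlocB ζ L ((η : ℂ) • A) j lam ν z μ‖
      ≤ (4 * d * a'' + 32 * C3 d L * a' ^ 2 + 8 * d * c₁ * a' + 2 * c₂ * a) * ((L : ℝ) ^ j * η) ^ 2 * θ := by
  have hL1 : 1 ≤ L := le_trans (by norm_num) hL
  set K : ℝ := (L : ℝ) ^ j with hK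
  set c : ℝ := C3 d L with hc
  have hK0 : 0 < K := by rw [hK]; positivity
  have hc0 : 0 < c := by rw [hc]; exact C3_pos d L hL1
  set x : ℝ := K * η with hx
  have hx0 : 0 < x := mul_pos hK0 hη
  have hx1 : x ≤ 1 := hθx.trans hθ1
  have hθ0 : 0 ≤ θ := hx0.le.trans hθx
  -- the `B`-variable sizes of `B = ηA`
  have hηn : ‖(η : ℂ)‖ = η := by rw [Complex.norm_real, Real.norm_of_nonneg hη.le]
  have hB : ∀ y κ, ‖((η : ℂ) • A) y κ‖ ≤ η * a := fun y κ => by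
    rw [Pi.smul_apply, Pi.smul_apply, norm_smul, hηn]
    exact mul_le_mul_of_nonneg_left (hA y κ) hη.le
  have hgLam : ∀ y κ, ‖((η : ℂ) • A) (y + e lam) κ - ((η : ℂ) • A) y κ‖ ≤ η * (η * a') := fun y κ => by
    rw [Pi.smul_apply, Pi.smul_apply, Pi.smul_apply, Pi.smul_apply, ← smul_sub, norm_smul, hηn]
    exact mul_le_mul_of_nonneg_left (hALam y κ) hη.le
  have hgν : ∀ y κ, ‖((η : ℂ) • A) (y + e ν) κ - ((η : ℂ) • A) y κ‖ ≤ η * (η * a') := fun y κ => by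
    rw [Pi.smul_apply, Pi.smul_apply, Pi.smul_apply, Pi.smul_apply, ← smul_sub, norm_smul, hηn]
    exact mul_le_mul_of_nonneg_left (hAν y κ) hη.le
  have hG : ∀ y, InBox (loK L j z) (bondHiK L j z μ + (((L : ℤ) ^ j - 1) • e ν)) y → ∀ κ,
      ‖(((η : ℂ) • A) (y + ((L : ℤ) ^ j) • e lam + e ν) κ - ((η : ℂ) • A) (y + ((L : ℤ) ^ j) • e lam) κ)
      - (((η : ℂ) • A) (y + e ν) κ - ((η : ℂ) • A) y κ)‖ ≤ η * (η * (a'' * θ)) := fun y hy κ => by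
    simp only [Pi.smul_apply]
    rw [← smul_sub, ← smul_sub, ← smul_sub, norm_smul, hηn]
    exact mul_le_mul_of_nonneg_left (hA2 y hy κ) hη.le
  -- the radius `b₁ = 1/(C₃L^j)` and the margin `r = b₁/4`
  set b₁ : ℝ := 1 / (c * K) with hb₁
  have hb₁0 : 0 < b₁ := by rw [hb₁]; positivity
  have hcKb₁ : c * (K * b₁) = 1 := by rw [hb₁]; field_simp
  have hk : c * (K * b₁) ≤ 1 := hcKb₁.le
  have hS : η * a + 2 * (K * (η * (η * a'))) ≤ b₁ / 2 := by
    have h1 : (η * a + 2 * (K * (η * (η * a')))) * (2 * c * K) ≤ 1 := by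
      have : c * (x * (2 * a + 4 * x * a')) = (η * a + 2 * (K * (η * (η * a')))) * (2 * c * K) := by rw [hx]; ring
      rw [← this]; exact hsmall
    have h2 : η * a + 2 * (K * (η * (η * a'))) ≤ 1 / (2 * c * K) := (le_div_iff₀ (by positivity)).2 h1
    have h3 : 1 / (2 * c * K) = b₁ / 2 := by rw [hb₁]; field_simp
    rwa [h3] at h2
  have hroom : η * a + 2 * (K * (η * (η * a'))) + 2 * (b₁ / 4) ≤ b₁ := by linarith
  have hδ₁0 : 0 ≤ c₁ * x := (abs_nonneg _).trans hζLam
  have hδ₂0 : 0 ≤ c₂ * x ^ 2 := (abs_nonneg _).trans hζ2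
  have h := ineq418_flat_local ζ L hL ((η : ℂ) • A) j lam ν z μ (b := η * a) (b₁ := b₁) (g := η * (η * a'))
    (g₂ := η * (η * (a'' * θ))) (r := b₁ / 4) (δ₁ := c₁ * x) (δ₂ := c₂ * x ^ 2) (by positivity) (by positivity)
    (by positivity) (by positivity) hk hroom hB hgLam hgν hG hζ0 hζLam hζν hζ2
  rw [hcKb₁] at h
  -- term by term
  have hT1 : 2 * d * K * (1 + 1) * (K * (η * (η * (a'' * θ)))) = 4 * d * a'' * x ^ 2 * θ := by rw [hx]; ring
  have hT2 : 2 * (K * b₁) * (K * (η * (η * a'))) * (K * (η * (η * a'))) / (b₁ / 4) ^ 2 = 32 * c * a' ^ 2 * x ^ 4 := by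
    rw [hx, hb₁]; field_simp; ring
  have hxx : x ^ 2 ≤ x := by
    have := mul_le_mul_of_nonneg_left hx1 hx0.le
    simpa [sq] using this
  have hx2θ : x ^ 2 ≤ θ := hxx.trans hθx
  have hx4 : x ^ 4 ≤ x ^ 2 * θ :=
    calc x ^ 4 = x ^ 2 * x ^ 2 := by ring
      _ ≤ x ^ 2 * θ := mul_le_mul_of_nonneg_left hx2θ (sq_nonneg x)
  have hx3 : x ^ 3 ≤ x ^ 2 * θ :=
    calc x ^ 3 = x ^ 2 * x := by ring
      _ ≤ x ^ 2 * θ := mul_le_mul_of_nonneg_left hθx (sq_nonneg x)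
  have hT2le : 32 * c * a' ^ 2 * x ^ 4 ≤ 32 * c * a' ^ 2 * (x ^ 2 * θ) :=
    mul_le_mul_of_nonneg_left hx4 (by positivity)
  have hηa : c * (K * (η * a)) ≤ 1 := by
    have : η * a ≤ b₁ := by
      have h0 : 0 ≤ 2 * (K * (η * (η * a'))) := by positivity
      linarith
    calc c * (K * (η * a)) ≤ c * (K * b₁) := by gcongr
      _ = 1 := hcKb₁
  have hXle : 2 * d * K * (1 + c * (K * (η * a))) * (K * (η * (η * a'))) ≤ 4 * d * a' * x ^ 2 := by
    have h12 : 1 + c * (K * (η * a)) ≤ 2 := by linarith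
    calc 2 * d * K * (1 + c * (K * (η * a))) * (K * (η * (η * a')))
        ≤ 2 * d * K * 2 * (K * (η * (η * a'))) :=
          mul_le_mul_of_nonneg_right (mul_le_mul_of_nonneg_left h12 (by positivity)) (by positivity)
      _ = 4 * d * a' * x ^ 2 := by rw [hx]; ring
  have hT3le : 2 * (c₁ * x * (2 * d * K * (1 + c * (K * (η * a))) * (K * (η * (η * a')))))
      ≤ 8 * d * c₁ * a' * (x ^ 2 * θ) := by
    have h1 : c₁ * x * (2 * d * K * (1 + c * (K * (η * a))) * (K * (η * (η * a'))))
        ≤ c₁ * x * (4 * d * a' * x ^ 2) := mul_le_mul_of_nonneg_left hXle hδ₁0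
    have hc₁ : 0 ≤ c₁ := nonneg_of_mul_nonneg_left hδ₁0 hx0
    have h2 : c₁ * x * (4 * d * a' * x ^ 2) = 4 * d * c₁ * a' * x ^ 3 := by ring
    have h3 : 4 * d * c₁ * a' * x ^ 3 ≤ 4 * d * c₁ * a' * (x ^ 2 * θ) :=
      mul_le_mul_of_nonneg_left hx3 (by positivity)
    linarith
  have hT4le : c₂ * x ^ 2 * (2 * (K * (η * a))) ≤ 2 * c₂ * a * (x ^ 2 * θ) := by
    have hc₂ : 0 ≤ c₂ := nonneg_of_mul_nonneg_left hδ₂0 (by positivity)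
    have h1 : c₂ * x ^ 2 * (2 * (K * (η * a))) = 2 * c₂ * a * x ^ 3 := by rw [hx]; ring
    have h2 : 2 * c₂ * a * x ^ 3 ≤ 2 * c₂ * a * (x ^ 2 * θ) := mul_le_mul_of_nonneg_left hx3 (by positivity)
    linarith
  have htotal : (4 * d * a'' + 32 * c * a' ^ 2 + 8 * d * c₁ * a' + 2 * c₂ * a) * x ^ 2 * θ
      = 4 * d * a'' * x ^ 2 * θ + 32 * c * a' ^ 2 * (x ^ 2 * θ) + 8 * d * c₁ * a' * (x ^ 2 * θ)
        + 2 * c₂ * a * (x ^ 2 * θ) := by ring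
  rw [htotal]
  rw [hT1, hT2] at h
  linarith

/-- Block boxes of the coarse points `z + w`, `0 ≤ w ≤ 2𝟙`, lie in a box `[lo, hi]` containing
`[Lʲz, Lʲz + (Lʲ−1)𝟙 + Lʲe_μ + 2Lʲ𝟙]`. [folklore] (bookkeeping) -/
private theorem blk_of_window {L j : ℕ} (hL : 1 ≤ L) {z lo hi : B7Prop1Explicit.Site d} {μ : Fin d}
    (hW : ∀ i, lo i ≤ loK L j z i ∧ bondHiK L j z μ i + 2 * (L : ℤ) ^ j ≤ hi i) (w : B7Prop1Explicit.Site d)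
    (hw : ∀ i, 0 ≤ w i ∧ w i ≤ 2) :
    ∀ i, lo i ≤ loK L j (z + w) i ∧ bondHiK L j (z + w) μ i ≤ hi i := by
  intro i
  obtain ⟨h1, h2⟩ := hW i
  obtain ⟨hw0, hw2⟩ := hw i
  have hLj : (1 : ℤ) ≤ (L : ℤ) ^ j := by exact_mod_cast Nat.one_le_pow j L (by omega)
  simp only [loK, bondHiK, Pi.add_apply] at h1 h2 ⊢
  constructor
  · nlinarith
  · split_ifs at h2 ⊢ <;> nlinarith

/-- **(I.4.18) «with η replaced by L⁻ⁿ» under LOCAL hypotheses**: with the (2.38)-shaped sizes of `A`, its fine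
differences and the (I.3.32) Hölder letter at scale `n` assumed ONLY on a box `[lo, hi] ⊇ [Lʲz, Lʲz + (Lʲ−1)𝟙 + Lʲe_μ +
2Lʲ𝟙]` of the fine lattice — print: (2.38) «on □∩X», [III] p. 276 «with η replaced by L⁻ⁿ» —
`‖(∂_λ∂_νB_μ)(z)‖ ≤ (4da″ + 32C₃a′² + 8dc₁a′ + 2c₂a)·(LʲL⁻ⁿ)²θ`: the clamping retraction supplies the sup and gradient
letters of the clamped field globally, the Hölder letter is used where clamping is the identity
(`ineq418_flat_scaled_local`). [cite: Balaban1988Convergent, (2.38) p.261, p.276, p.280; Balaban1987RG1, (4.18) p.285] -/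
theorem ineq418_scaleN_local (ζ : B7Prop1Explicit.Site d → ℝ) (L : ℕ) (hL : 2 ≤ L)
    (A : B7Prop1Explicit.Site d → Fin d → 𝔸) (j n : ℕ) (lam ν : Fin d) (z : B7Prop1Explicit.Site d) (μ : Fin d)
    {η a a' a'' θ c₁ c₂ : ℝ} (hη : η = ((L : ℝ) ^ n)⁻¹) (ha : 0 ≤ a) (ha' : 0 ≤ a') (ha'' : 0 ≤ a'')
    (hθx : (L : ℝ) ^ j * η ≤ θ) (hθ1 : θ ≤ 1)
    (hsmall : C3 d L * ((L : ℝ) ^ j * η * (2 * a + 4 * ((L : ℝ) ^ j * η) * a')) ≤ 1)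
    {lo hi : B7Prop1Explicit.Site d} (hW : ∀ i, lo i ≤ loK L j z i ∧ bondHiK L j z μ i + 2 * (L : ℤ) ^ j ≤ hi i)
    (hA : ∀ x, InBox lo hi x → ∀ κ, ‖A x κ‖ ≤ a)
    (hA' : ∀ x (ν' : Fin d), InBox lo hi x → InBox lo hi (x + e ν') → ∀ κ, ‖A (x + e ν') κ - A x κ‖ ≤ η * a')
    (hA2 : ∀ y, InBox lo hi y → InBox lo hi (y + ((L : ℤ) ^ j) • e lam + e ν) → ∀ κ,
      ‖(A (y + ((L : ℤ) ^ j) • e lam + e ν) κ - A (y + ((L : ℤ) ^ j) • e lam) κ) - (A (y + e ν) κ - A y κ)‖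
        ≤ η * (a'' * θ))
    (hζ0 : |ζ z| ≤ 1) (hζLam : |ζ (z + e lam) - ζ z| ≤ c₁ * ((L : ℝ) ^ j * η))
    (hζν : |ζ (z + e ν) - ζ z| ≤ c₁ * ((L : ℝ) ^ j * η))
    (hζ2 : |ζ (z + e lam + e ν) - ζ (z + e lam) - ζ (z + e ν) + ζ z| ≤ c₂ * ((L : ℝ) ^ j * η) ^ 2) :
    ‖ddlocB ζ L ((η : ℂ) • A) j lam ν z μ‖
      ≤ (4 * d * a'' + 32 * C3 d L * a' ^ 2 + 8 * d * c₁ * a' + 2 * c₂ * a)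
          * ((L : ℝ) ^ j * ((L : ℝ) ^ n)⁻¹) ^ 2 * θ := by
  have hL1 : 1 ≤ L := le_trans (by norm_num) hL
  have hL0 : (0 : ℝ) < L := by exact_mod_cast lt_of_lt_of_le (by norm_num) hL
  have hηpos : 0 < η := by rw [hη]; positivity
  have hLj : (1 : ℤ) ≤ (L : ℤ) ^ j := by exact_mod_cast Nat.one_le_pow j L (by omega)
  have hbox : ∀ i, lo i ≤ hi i := fun i => by
    obtain ⟨h1, h2⟩ := hW i
    simp only [loK, bondHiK] at h1 h2
    split_ifs at h2 <;> nlinarith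
  -- the four coarse points have their blocks inside the box
  have hb00 := blk_of_window (μ := μ) hL1 hW 0 (fun i => by simp)
  have hb10 := blk_of_window (μ := μ) hL1 hW (e lam) (fun i => by
    rw [B7Prop1Explicit.e_apply]; split_ifs <;> simp)
  have hb01 := blk_of_window (μ := μ) hL1 hW (e ν) (fun i => by
    rw [B7Prop1Explicit.e_apply]; split_ifs <;> simp)
  have hb11 := blk_of_window (μ := μ) hL1 hW (e lam + e ν) (fun i => by
    rw [Pi.add_apply, B7Prop1Explicit.e_apply, B7Prop1Explicit.e_apply]; split_ifs <;> simp)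
  rw [add_zero] at hb00
  -- pass to the clamped field
  have e00 := locB_clamp_eq ζ L hL1 A j z μ η hb00
  have e10 := locB_clamp_eq ζ L hL1 A j (z + e lam) μ η hb10
  have e01 := locB_clamp_eq ζ L hL1 A j (z + e ν) μ η hb01
  have e11 := locB_clamp_eq ζ L hL1 A j (z + (e lam + e ν)) μ η hb11
  rw [← add_assoc] at e11
  have hdd : ddlocB ζ L ((η : ℂ) • A) j lam ν z μ
      = ddlocB ζ L ((η : ℂ) • fun (x : B7Prop1Explicit.Site d) (κ : Fin d) => A (fun i => max (lo i) (min (x i) (hi i))) κ)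
          j lam ν z μ := by
    unfold ddlocB dlocB
    rw [e00, e10, e01, e11]
  rw [hdd]
  -- the clamped field has the global sup and gradient letters and the local Hölder letter
  have hAc := clamp_sup hbox A hA
  have hAcLam := clamp_diff hbox A lam (by positivity : 0 ≤ η * a') (fun x hx hx' κ => hA' x lam hx hx' κ)
  have hAcν := clamp_diff hbox A ν (by positivity : 0 ≤ η * a') (fun x hx hx' κ => hA' x ν hx hx' κ)
  have hAc2 : ∀ y, InBox (loK L j z) (bondHiK L j z μ + (((L : ℤ) ^ j - 1) • e ν)) y → ∀ κ,
      ‖((fun (x : B7Prop1Explicit.Site d) (κ : Fin d) => A (fun i => max (lo i) (min (x i) (hi i))) κ)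
            (y + ((L : ℤ) ^ j) • e lam + e ν) κ
          - (fun (x : B7Prop1Explicit.Site d) (κ : Fin d) => A (fun i => max (lo i) (min (x i) (hi i))) κ)
            (y + ((L : ℤ) ^ j) • e lam) κ)
        - ((fun (x : B7Prop1Explicit.Site d) (κ : Fin d) => A (fun i => max (lo i) (min (x i) (hi i))) κ) (y + e ν) κ
          - (fun (x : B7Prop1Explicit.Site d) (κ : Fin d) => A (fun i => max (lo i) (min (x i) (hi i))) κ) y κ)‖
        ≤ η * (a'' * θ) := by
    intro y hy κ
    -- the four points lie in the box, where clamping is the identity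
    have hy4 : ∀ i, lo i ≤ y i ∧ y i + (L : ℤ) ^ j + 1 ≤ hi i := fun i => by
      obtain ⟨h1, h2⟩ := hW i
      obtain ⟨h3, h4⟩ := hy i
      simp only [loK, bondHiK, Pi.add_apply, Pi.smul_apply, B7Prop1Explicit.e_apply, smul_eq_mul, mul_ite,
        mul_one, mul_zero] at h1 h2 h3 h4
      constructor
      · nlinarith
      · split_ifs at h2 h4 <;> nlinarith
    have hin : ∀ w : B7Prop1Explicit.Site d, (∀ i, 0 ≤ w i ∧ w i ≤ (L : ℤ) ^ j + 1) → InBox lo hi (y + w) := by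
      intro w hw i
      obtain ⟨h1, h2⟩ := hy4 i
      obtain ⟨h3, h4⟩ := hw i
      simp only [Pi.add_apply]
      constructor <;> omega
    have i00 : InBox lo hi y := by simpa using hin 0 (fun i => by simp; positivity)
    have i01 : InBox lo hi (y + e ν) := hin (e ν) (fun i => by
      rw [B7Prop1Explicit.e_apply]; split_ifs <;> constructor <;> nlinarith)
    have i10 : InBox lo hi (y + ((L : ℤ) ^ j) • e lam) := hin (((L : ℤ) ^ j) • e lam) (fun i => by
      rw [Pi.smul_apply, B7Prop1Explicit.e_apply]
      split_ifs
      · simp only [smul_eq_mul, mul_one]; constructor <;> nlinarith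
      · simp only [smul_eq_mul, mul_zero]; constructor <;> nlinarith)
    have i11 : InBox lo hi (y + ((L : ℤ) ^ j) • e lam + e ν) := by
      rw [add_assoc]
      exact hin (((L : ℤ) ^ j) • e lam + e ν) (fun i => by
        rw [Pi.add_apply, Pi.smul_apply, B7Prop1Explicit.e_apply, B7Prop1Explicit.e_apply]
        split_ifs <;> simp <;> nlinarith)
    simp only []
    rw [clamp_eq_self i00, clamp_eq_self i01, clamp_eq_self i10, clamp_eq_self i11]
    exact hA2 y i00 i11 κ
  have h := ineq418_flat_scaled_local ζ L hL _ j lam ν z μ hηpos ha ha' ha'' hθx hθ1 hsmall hAc hAcLam hAcν hAc2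
    hζ0 hζLam hζν hζ2
  rw [← hη]
  exact h

end Local418

end Literature.MathematicalPhysics.QuantumFieldTheory.Balaban1983to89.B14.LettersScaleNLocal

end
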